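import Summits.BirchSwinnertonDyer.BirchSwinnertonDyer.Theorems.ResidualThetaTransportAtTwoResidualSignedLambdaLowerCMAtTwoRhoLayerPairingCompat
import Summits.BirchSwinnertonDyer.BirchSwinnertonDyer.Theorems.ResidualThetaTransportAtTwoResidualSignedLambdaLowerCMAtTwoStubDeepHalfAtTwoStrictPins
import Literature.NumberTheory.GaloisRepresentations.ContinuousShapiroLiftCupAdjoint
import Literature.NumberTheory.GaloisRepresentations.ContinuousShapiroOpenCoinducedDescent
import HarnessLib

/-!
# The layer Tate pairings are ADJOINT for coefficient endomorphisms balanced by `e` — `⟨α_* x, y⟩_{n,N} = ⟨x, β_* y⟩_{n,N}` whenever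
# `e(α s, t) = e(s, β t)`; in particular the `𝒪`-BALANCE `⟨a • b, y⟩ = ⟨b, a • y⟩` of the one-pair tower (`e_k(a s, t) = e_k(s, a t)`)

Route `ResidualThetaTransportAtTwo` (RTT), crux RSL_g `ResidualSignedLambdaLowerCMAtTwo` (stmt-BirchSwinnertonDyer-22608), line «onepair» (v3d), GLUE-SPEC-g18 T2(b):
the LEAD's `AwayPins` existence (E3) needs `hlocdS_smul` — the `ℤ₂`/`𝒪`-balance of the S₀-side characters — which reduces to the 𝒪-balance of the layer
pairing (LEAD g19, STATUS 07:32:10Z, sub-lemma «`…LayerPairingScalar`»). Seat `prover-bsd-wall-tp2-p2x-w2` g20 (`--supports`, closes nothing). THEOREMS ONLY.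
BSD is not proved by any of this; RSL_g (22608) stays OPEN.

* §1 (generic discrete module `M`, level `N`, datum `e`): `localPairingOfFun_map_adjoint`, **`layerPairingH1Of_map_adjoint`** — for endomorphisms `α β` of the
  local coefficient module with `e (α s) t = e s (β t)`: `⟨α_* x, y⟩_{n,N} = ⟨x, β_* y⟩_{n,N}` on `H¹(U_n, M|)` (tree `shapiroLift_cupProduct_coindFin_map_adjoint`
  with `γ := 𝟙`, `cohomologyMap_id_apply`); **`layerPairingOf_map_adjoint`** — the same with a GLOBAL endomorphism on the first (global) argument
  (`layerLocOf_cohomologyMap`).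
* §2 (the one-pair pins): **`OnePairPins.ePk_smul_comm`** — `e_k(2^{-k}(a s), 2^{-k} t) = e_k(2^{-k} s, 2^{-k}(a t))` for `a ∈ 𝒪` (value formula `hePk`: both
  exponents are `t₀(a (s ∧ t))`): the balance hypothesis `hc` of §1 for ANY scalar endomorphism of `A_ρ[2^k]` acting as `a` on `T_ρ/2^k`.

References: [NeukirchSchmidtWingberg2008] I §4 (1.4.2), I §6 (1.6.4); [PerrinRiou1994Invent] §3.6.1; [Kato2004Asterisque] §13.8 (pp. 228–229).
-/

set_option autoImplicit false
-- the Theorems namespace of this sub repeats the summit name by design (D-0017 nested layout)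
set_option linter.dupNamespace false

noncomputable section

open scoped Classical

namespace Summit.BirchSwinnertonDyer.BirchSwinnertonDyer.Theorems.ThetaTransport

open CategoryTheory Field NumberField IsDedekindDomain
  Literature.NumberTheory.EllipticCurves Literature.NumberTheory.GaloisRepresentations
  Literature.NumberTheory.EllipticCurves.GreenbergSelmer Literature.NumberTheory.EllipticCurves.CyclotomicLayer
  Literature.NumberTheory.GaloisCohomology ZpExtension
  Literature.NumberTheory.GaloisRepresentations.DiscreteGaloisModule


/-! ## §1 Generic coefficients: adjoint endomorphisms -/

section Generic

variable {p : ℕ} [Fact p.Prime] {M : Type} [AddCommGroup M] [TopologicalSpace M] [DiscreteTopology M]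
  (ρM : DiscreteGaloisModule ℚ M) (N : ℕ) [NeZero N]
  (e : M → M → AlgebraicClosure ℚ)
  (hμ : ∀ S T, e S T ^ N = 1)
  (hadd₁ : ∀ S₁ S₂ T, e (S₁ + S₂) T = e S₁ T * e S₂ T)
  (hadd₂ : ∀ S T₁ T₂, e S (T₁ + T₂) = e S T₁ * e S T₂)
  (hgal : ∀ (σ : absoluteGaloisGroup ℚ) (S T : M), σ • e S T = e (ρM σ S) (ρM σ T))
  (κ : ZpExtension ℚ p) (v : HeightOneSpectrum (𝓞 ℚ))

/-- The module identity: `e(α s, t) = e(s, β t)` read on the local pairing of `TopRep`s, with `γ = 𝟙`. [cite: NeukirchSchmidtWingberg2008, I §4 (1.4.2)] -/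
theorem localPairingOfFun_map_adjoint (α β : localRepOf ρM v ⟶ localRepOf ρM v) (hc : ∀ s t, e (α.hom s) t = e s (β.hom t)) (s t : M) :
    (𝟙 (muLocalRep N v) : muLocalRep N v ⟶ muLocalRep N v).hom ((localPairingOfFun ρM N e hμ hadd₁ hadd₂ hgal v).toLin (α.hom s) t) =
      (localPairingOfFun ρM N e hμ hadd₁ hadd₂ hgal v).toLin s (β.hom t) := by
  change (localPairingOfFun ρM N e hμ hadd₁ hadd₂ hgal v).toLin (α.hom s) t = _
  rw [localPairingOfFun_toLin_apply, localPairingOfFun_toLin_apply, muCarrier_eq_iff, coe_pairingHomOfFun, coe_pairingHomOfFun]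
  exact hc s t

/-- **Adjoint endomorphisms give adjoint layer pairings**: if `e(α s, t) = e(s, β t)` for endomorphisms `α, β` of the local coefficient module, then
`⟨α_* x, y⟩_{n,N} = ⟨x, β_* y⟩_{n,N}` on `H¹(U_n, M|) × H¹(U_n, M|)` (Shapiro, summed cup product with `γ = 𝟙`, the invariant map).
[cite: NeukirchSchmidtWingberg2008, I §4 (1.4.2), I §6 (1.6.4)] [cite: PerrinRiou1994Invent, §3.6.1] -/
theorem layerPairingH1Of_map_adjoint (α β : localRepOf ρM v ⟶ localRepOf ρM v) (hc : ∀ s t, e (α.hom s) t = e s (β.hom t)) (n : ℕ)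
    (x y : continuousCohomology 1 (subgroupRep (localRepOf ρM v) (layerGroup κ v n))) :
    layerPairingH1Of ρM N e hμ hadd₁ hadd₂ hgal κ v n (cohomologyMap (subgroupRepMap α (layerGroup κ v n)) 1 x) y =
      layerPairingH1Of ρM N e hμ hadd₁ hadd₂ hgal κ v n x (cohomologyMap (subgroupRepMap β (layerGroup κ v n)) 1 y) := by
  haveI : CompactSpace (absoluteGaloisGroup (v.adicCompletion ℚ)) := absoluteGaloisGroup_compactSpace _
  letI : Fintype (absoluteGaloisGroup (v.adicCompletion ℚ) ⧸ layerGroup κ v n) := layerFintypeQuot κ v n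
  rw [layerPairingH1Of_apply, layerPairingH1Of_apply]
  have h := shapiroLift_cupProduct_coindFin_map_adjoint (localPairingOfFun ρM N e hμ hadd₁ hadd₂ hgal v)
    (localPairingOfFun ρM N e hμ hadd₁ hadd₂ hgal v) α β (𝟙 (muLocalRep N v)) (layerGroup κ v n) (isOpen_layerGroup κ v n)
    (layerReps_spec κ v n) (layerReps_one κ v n) (localPairingOfFun_map_adjoint ρM N e hμ hadd₁ hadd₂ hgal v α β hc) x y
  rw [cohomologyMap_id_apply] at h
  unfold layerShapiroOf layerSumPairingOf
  exact congrArg _ h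

/-- **The same with a GLOBAL endomorphism on the global first argument**: for `α' : M → M` a morphism of `Γ_ℚ`-modules whose restriction to `Γ_v` is
balanced against `β` by `e`, `⟨loc_n (α'_* b), y⟩ = ⟨loc_n b, β_* y⟩` (`layerLocOf_cohomologyMap` + the above). [cite: Kobayashi2003, (8.23) (p. 18)]
[cite: NeukirchSchmidtWingberg2008, I §4 (1.4.2)] -/
theorem layerPairingOf_map_adjoint (α' : ρM.toTopRep ⟶ ρM.toTopRep) (β : localRepOf ρM v ⟶ localRepOf ρM v)
    (hc : ∀ s t, e (α'.hom s) t = e s (β.hom t)) (n : ℕ) (b : H1 ρM (κ.layerSubgroup n))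
    (y : continuousCohomology 1 (subgroupRep (localRepOf ρM v) (layerGroup κ v n))) :
    layerPairingOf ρM N e hμ hadd₁ hadd₂ hgal κ v n (cohomologyMap (subgroupRepMap α' (κ.layerSubgroup n)) 1 b) y =
      layerPairingOf ρM N e hμ hadd₁ hadd₂ hgal κ v n b (cohomologyMap (subgroupRepMap β (layerGroup κ v n)) 1 y) := by
  rw [layerPairingOf_apply, layerPairingOf_apply, layerLocOf_cohomologyMap]
  exact layerPairingH1Of_map_adjoint ρM N e hμ hadd₁ hadd₂ hgal κ v _ β (fun s t ↦ hc s t) n _ y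

end Generic

end Summit.BirchSwinnertonDyer.BirchSwinnertonDyer.Theorems.ThetaTransport

/-! ## §2 The one-pair pins: `e_k` is `𝒪`-balanced -/

namespace Summit.BirchSwinnertonDyer.BirchSwinnertonDyer.Theorems.OnePair.OnePairPins

open CategoryTheory Field NumberField IsDedekindDomain
  Literature.NumberTheory.EllipticCurves Literature.NumberTheory.GaloisRepresentations
  Literature.NumberTheory.EllipticCurves.GreenbergSelmer Literature.NumberTheory.EllipticCurves.Kobayashi2003

variable {S : Set (PadicAlgCl 2)} {W : WeierstrassCurve ℚ} [W.IsElliptic] {κ : ZpExtension ℚ 2} {γ : absoluteGaloisGroup ℚ}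
  {S₀ : Finset (HeightOneSpectrum (𝓞 ℚ))} {n : ℕ} {ρ : FramedGaloisRep ℚ ↥(padicCoeffIntegers S) 2}
  {Θ : ∀ v : HeightOneSpectrum (𝓞 ℚ), ((2 : ℕ) : 𝓞 ℚ) ∈ v.asIdeal → (Cofree ρ ↥(padicCoeffField S) ≃+ (Fin n → ↥(W.geomPrimaryTorsion 2)))}
  {hΘ : ∀ v hv (δ : absoluteGaloisGroup (v.adicCompletion ℚ)) m i,
    Θ v hv (resGalOfEmb (closureEmb (K := ℚ) (v.adicCompletion ℚ)) δ • m) i = resGalOfEmb (closureEmb (K := ℚ) (v.adicCompletion ℚ)) δ • Θ v hv m i}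
  {I : Kato2004.IwasawaH1DataCoeff (FramedGaloisRep.toGaloisRep ρ) 2 κ γ}
  {Sg : AddSubgroup (subgroupH1 κ.kerSubgroup (Cofree ρ ↥(padicCoeffField S)))} [Module ↥(padicCoeffIntegers S) ↥Sg]
  (π : OnePairPins S W κ γ S₀ n ρ Θ hΘ I Sg)

/-- **The tower `e_k` is `𝒪`-balanced**: `e_k(2^{-k}(a s), 2^{-k} t) = e_k(2^{-k} s, 2^{-k}(a t))` for `a ∈ 𝒪`, `s, t ∈ T_ρ = 𝒪²` — both are
`ζ_k^{t₀(a(s₀t₁ − s₁t₀))}` by the value formula `hePk`. Since `T_ρ/2^k ↠ A_ρ[2^k]` (`divPowCofreeMkTorsion_surjective`), this is the balance hypothesis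
`e(α s, t) = e(s, β t)` of `ThetaTransport.layerPairingH1Of_map_adjoint` for any endomorphism of `A_ρ[2^k]` acting as `a` on coordinates: `⟨a • b, y⟩ = ⟨b, a • y⟩`.
[cite: Kato2004Asterisque, §13.8 (pp. 228–229)] -/
theorem ePk_smul_comm (k : ℕ) (a : ↥(padicCoeffIntegers S)) (s t : Fin 2 → ↥(padicCoeffIntegers S)) :
    π.ePk k (divPowCofreeMkTorsion S ρ k (a • s)) (divPowCofreeMkTorsion S ρ k t) =
      π.ePk k (divPowCofreeMkTorsion S ρ k s) (divPowCofreeMkTorsion S ρ k (a • t)) := by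
  rw [π.hePk, π.hePk]
  congr 3
  simp only [Pi.smul_apply, smul_eq_mul]
  ring

end Summit.BirchSwinnertonDyer.BirchSwinnertonDyer.Theorems.OnePair.OnePairPins

end
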